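import Summits.QuantumFields.BalabanUV.Beta.D1BFx.DressedTablesLeg

/-!
# `BalabanUV.Beta.D1BFx.ReducedKernelSandwichLeg` — road «BF-x» for binder row D1, sub-leaf A4-leg (part 2, END): THE REDUCED ONE-SHOT
# KERNEL OVER ANY LEG IS AN `ℋ`-SANDWICH OF AN EXPLICIT BLOCK-PERIODIC FINE HESSIAN KERNEL —
# `TOfLeg n A S (tableRedF n Wf) μ ν z = dressedEntryP (wK n) (fineHessA A S Wf) (n•(−z)) μ ν`, `fineHessA = ½·tadpole-table − ½·bubble-table`;
# hence (K-R5) `n⁸ · Σ'_z z_κ z_λ TOfLeg … μ ν z = avgM2 n (fineHessA μ ν) κ λ` GIVEN the per-entry Ward row sums and parity of `fineHessA`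
# (the dressing cross terms `X_n` VANISH) — for EVERY leg with `Spr A` + block covariance, in particular THE GHOST LEG `GhostLeg.Ggh n a`

HONEST DEPENDENCY (page 1, mandatory): continuum YM on T⁴ ⇐ BetaPertH ∧ nine spine estimates (0/9 proved); BetaPertH ⇐ (D1) ∧ (D4) ∧
CAP+tail; G-an2-4 gates asym, D1 and NE2/3/4.  HONEST FRAMING (cell contract, verbatim): «discharging `BetaPertH` makes Bałaban's UV
stability UNCONDITIONAL — a real constructive-QFT result; it is NOT the continuum limit and NOT the Clay problem.»  One definition with a
body ([our object] `fineHessA`) and [folklore] bookkeeping composed BY NAME from part 1 (`DressedTablesLeg`), leaf A4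
(`ReducedKernelSandwich.dressedEntryP_add`, `MomentTransferParity.sum_firstMoment_baseKer_eq_zero_of_inversion`), K-R5
(`MomentTransferPeriodicEntry.bondSecondMomentP_solutionOp_four`), T8-gh (`ReducedKernelF.TOfLeg`/`TOfGh`) and the typer's T2/T8-tab
(`GhostLeg.spr_Ggh`/`shiftK_Ggh_neg`, `ReducedTableF.tableRedF`).  HYPOTHESES THAT STAY HYPOTHESES (named, never minted): `Spr A` and the
block covariance of the leg; the SYMMETRY of the fine second-order table `Wf κ′ u λ′ u′ = Wf λ′ u′ κ′ u`; the per-entry ROW SUMS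
`Σ_{s′} fineHessA κ′ λ′ b s′ = 0` (`hrow`: THE WARD IDENTITY of the gauge-invariant piece in kernel form — node A3.b; NOT proved here) and
the base-point-summed FIRST MOMENTS (`hT1`) or the affine INVERSION covariance (`hinv`) (reflection parity, node R5 (T1); NOT proved here).
No `def … : Prop`, no citation, nothing of the manuscripts under audit asserted; 0 binders of the hR root touched; nothing of D1 / BetaPertH
discharged.  Value = kernel bookkeeping leaf of road BF-x (skeleton v1.4 nodes R4/R5/A4/A7, «for P ∈ {Pgl n, Pgh n}»), NOT summit progress.
ABSOLUTE RULE (cell charter, verbatim): «No internally-minted statement may enter as a cited fact. Every hypothesis is either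
kernel-proved in this package or a verbatim quotation of a PUBLISHED theorem with page reference. The manuscript(s) under audit are NOT
citable for their own disputed steps — they are the thing under adjudication; programme-internal (2001/route/tribunal) claims are never
citable.»

CONTENT.
* §1 [our object] `fineHessA A S Wf := tadpoleTableA A Wf + bubbleTableA A S`; [folklore] `isBlockPeriodic_fineHessA`, `absMoment₂_baseKer_fineHessA`,
  `fineHessA_transpose`; CONSISTENCY `fineHessA_Ga : fineHessA (Ga n a) S Wf = ReducedKernelSandwich.fineHess n a S Wf` (`rfl`) — the
  gluon chain of leaf A4 is the instance `A := Ga n a`.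
* §2 [folklore] **`TOfLeg_tableRedF_eq_dressedEntryP`** (the sandwich identity over any leg).
* §3 [folklore] **`bondSecondMoment_TOfLeg_eq_avgM2`**, `secondMoment_TOfLeg_eq` (Ward rows + first moments as hypotheses),
  **`bondSecondMoment_TOfLeg_eq_avgM2_of_inversion`** (first moments discharged by an inversion covariance).
* §4 [folklore] THE GHOST INSTANCE (`0 < a`, fibre `Unit`, leg `Ggh n a`): `TOfGh_tableRedF_eq_dressedEntryP`,
  `bondSecondMoment_TOfGh_eq_avgM2`, `secondMoment_TOfGh_eq`, `bondSecondMoment_TOfGh_eq_avgM2_of_inversion` — what A7 reads for the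
  ghost sector; leaf-04's `GhostKernel.Pgh` (table slot `tableRedDiag`, p210351) plugs in once its diagonal table is written as a
  `tableRedF` (one `tsum_ite_eq` bridge, filed when that module lands).
Unit `b2b-balaban-beta-d1-formalise-leaf-01` (gen 2).
-/

noncomputable section

namespace Summit.QuantumFields.BalabanUV.Beta.D1BFx.ReducedKernelSandwichLeg

open Finset
open scoped BigOperators
open Literature.MathematicalPhysics.QuantumFieldTheory.Balaban1983to89
open Literature.MathematicalPhysics.QuantumFieldTheory.Balaban1983to89.Beta
open B12Sec2to5 (l1 l1_nonneg)
open ExpKernelCalculus (Site MKer Decays BiLoc comp tr bubble tadpole hessKer shiftK)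
open DecimatedMoment (cosetInd)
open DecimatedMomentSummable (AbsMoment₂)
open DressedMomentNormalisation (EKer resSite)
open KernelSpecInstance (wH)
open MinimiserIdentityForm (wK absMoment₂_wK)
open OneStepResolventKernel (wsum)
open Summit.QuantumFields.BalabanUV.Beta.TameKernelCalculus
open Summit.QuantumFields.BalabanUV.Beta.D1BFx.GluonLeg (Ga)
open Summit.QuantumFields.BalabanUV.Beta.D1BFx.GhostLeg (Ggh spr_Ggh shiftK_Ggh_neg)
open Summit.QuantumFields.BalabanUV.Beta.D1BFx.ReducedKernel (StencilR)
open Summit.QuantumFields.BalabanUV.Beta.D1BFx.ReducedKernelF (vertexRedF TOfLeg TOfGh TOfLeg_eq)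
open Summit.QuantumFields.BalabanUV.Beta.D1BFx.ReducedTableF (tableRedF)
open Summit.QuantumFields.BalabanUV.Beta.D1BFx.DressedTadpoleTable (Table₂R)
open Summit.QuantumFields.BalabanUV.Beta.D1BFx.ReducedKernelSandwich (fineHess dressedEntryP_add absMoment₂_add')
open Summit.QuantumFields.BalabanUV.Beta.D1BFx.MomentTransferPeriodic (Ker₂ IsBlockPeriodic baseKer)
open Summit.QuantumFields.BalabanUV.Beta.D1BFx.MomentTransferPeriodicSum (dressedSumP periodicMajorant absMoment₂_periodicMajorant
  abs_baseKer_le_periodicMajorant)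
open Summit.QuantumFields.BalabanUV.Beta.D1BFx.MomentTransferPeriodicEntry (EKer₂ dressedEntryP avgM2
  bondSecondMomentP_solutionOp_four)
open Summit.QuantumFields.BalabanUV.Beta.D1BFx.MomentTransferParity (sum_firstMoment_baseKer_eq_zero_of_inversion)
open Summit.QuantumFields.BalabanUV.Beta.D1BFx.DressedTablesLeg

variable {F : Type*} [Fintype F]

/-! ## §1 The fine Hessian kernel of the reduced piece over a generic leg -/

/-- [our object] **THE FINE HESSIAN KERNEL OVER THE LEG `A`**: `fineHessA A S Wf κ′ λ′ u u′ := ½·tadpole A (Wf κ′ u λ′ u′) −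
½·bubble A (S κ′ u) (S λ′ u′)` (= `tadpoleTableA + bubbleTableA` entrywise).  A DEFINITION; asserts nothing. -/
def fineHessA (A : MKer 4 F) (S : Fin 4 → Site 4 → MKer 4 F) (Wf : Fin 4 → Site 4 → Fin 4 → Site 4 → MKer 4 F) : EKer₂ 4 :=
  fun κ' l' u u' => tadpoleTableA A Wf κ' l' u u' + bubbleTableA A S κ' l' u u'

/-- [our object] Unfolding. -/
theorem fineHessA_apply (A : MKer 4 F) (S : Fin 4 → Site 4 → MKer 4 F) (Wf : Fin 4 → Site 4 → Fin 4 → Site 4 → MKer 4 F)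
    (κ' l' : Fin 4) (u u' : Site 4) :
    fineHessA A S Wf κ' l' u u' = tadpoleTableA A Wf κ' l' u u' + bubbleTableA A S κ' l' u u' := rfl

/-- [folklore] **CONSISTENCY WITH LEAF A4**: at the gluon leg the generic kernel IS `ReducedKernelSandwich.fineHess` (definitionally). -/
theorem fineHessA_Ga (n : ℕ) [NeZero n] (a : ℝ) (S : StencilR) (Wf : Table₂R) :
    fineHessA (Ga n a) S Wf = fineHess n a S Wf := rfl

variable (n : ℕ) [NeZero n] (A : MKer 4 F) {S : Fin 4 → Site 4 → MKer 4 F} {Wf : Fin 4 → Site 4 → Fin 4 → Site 4 → MKer 4 F}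
  {Cs C2 δ : ℝ}

omit [NeZero n] in
/-- [folklore] Block periodicity of the fine Hessian kernel. -/
theorem isBlockPeriodic_fineHessA (hAcov : ∀ t : Site 4, shiftK (-((n : ℤ) • t)) A = A)
    (hScov : ∀ (κ' : Fin 4) (u v : Site 4), S κ' (u + v) = shiftK (-v) (S κ' u))
    (hWcov : ∀ (κ' : Fin 4) (u : Site 4) (l' : Fin 4) (u' v : Site 4), Wf κ' (u + v) l' (u' + v) = shiftK (-v) (Wf κ' u l' u'))
    (κ' l' : Fin 4) : IsBlockPeriodic n (fineHessA A S Wf κ' l') := fun t s s' => by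
  simp only [fineHessA_apply, isBlockPeriodic_tadpoleTableA n A hAcov hWcov κ' l' t s s',
    isBlockPeriodic_bubbleTableA n A hAcov hScov κ' l' t s s']

variable [Nonempty F]

/-- [folklore] Absolutely summable base-point kernels of the fine Hessian kernel. -/
theorem absMoment₂_baseKer_fineHessA (hA : Spr A) (hS : ∀ κ' u, BiLoc (S κ' u) u u Cs δ)
    (hW : ∀ κ' u l' u', BiLoc (Wf κ' u l' u') u u' C2 δ) (hδ : 0 < δ) (κ' l' : Fin 4) (b : Site 4) :
    AbsMoment₂ (baseKer (fineHessA A S Wf κ' l') b) :=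
  absMoment₂_add' (absMoment₂_baseKer_tadpoleTableA A hA hW hδ κ' l' b) (absMoment₂_baseKer_bubbleTableA A hA hS hδ κ' l' b)

omit [Nonempty F] in
/-- [folklore] MATRIX SYMMETRY of the fine Hessian kernel (`fineHessA κ′λ′ u u′ = fineHessA λ′κ′ u′ u`) for a SYMMETRIC fine table. -/
theorem fineHessA_transpose (hA : Spr A) (hS : ∀ κ' u, BiLoc (S κ' u) u u Cs δ) (hδ : 0 < δ)
    (hWsymm : ∀ (κ' : Fin 4) (u : Site 4) (l' : Fin 4) (u' : Site 4), Wf κ' u l' u' = Wf l' u' κ' u)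
    (κ' l' : Fin 4) (u u' : Site 4) : fineHessA A S Wf κ' l' u u' = fineHessA A S Wf l' κ' u' u := by
  simp only [fineHessA_apply, tadpoleTableA_apply]
  rw [hWsymm κ' u l' u', bubbleTableA_transpose A hA hS hδ κ' l' u u']

/-! ## §2 The reduced kernel over any leg as a sandwich -/

/-- [folklore] **THE WHOLE REDUCED ONE-SHOT KERNEL OVER THE LEG `A` IS AN `ℋ`-SANDWICH OF THE FINE HESSIAN KERNEL**:
`TOfLeg n A S (tableRedF n Wf) μ ν z = dressedEntryP (wK n) (fineHessA A S Wf) (n•(−z)) μ ν`. -/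
theorem TOfLeg_tableRedF_eq_dressedEntryP (hA : Spr A) (hAcov : ∀ t : Site 4, shiftK (-((n : ℤ) • t)) A = A)
    (hS : ∀ κ' u, BiLoc (S κ' u) u u Cs δ) (hW : ∀ κ' u l' u', BiLoc (Wf κ' u l' u') u u' C2 δ) (hδ : 0 < δ)
    (hScov : ∀ (κ' : Fin 4) (u v : Site 4), S κ' (u + v) = shiftK (-v) (S κ' u))
    (hWcov : ∀ (κ' : Fin 4) (u : Site 4) (l' : Fin 4) (u' v : Site 4), Wf κ' (u + v) l' (u' + v) = shiftK (-v) (Wf κ' u l' u'))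
    (μ ν : Fin 4) (z : Site 4) :
    TOfLeg n A S (tableRedF n Wf) μ ν z = dressedEntryP (wK n) (fineHessA A S Wf) ((n : ℤ) • (-z)) μ ν := by
  have hadd := dressedEntryP_add (Nat.pos_of_ne_zero (NeZero.ne n)) (wK n) (tadpoleTableA A Wf) (bubbleTableA A S) absMoment₂_wK
    (fun c e => isBlockPeriodic_tadpoleTableA n A hAcov hWcov c e) (fun c e => isBlockPeriodic_bubbleTableA n A hAcov hScov c e)
    (fun c e b => absMoment₂_baseKer_tadpoleTableA A hA hW hδ c e b) (fun c e b => absMoment₂_baseKer_bubbleTableA A hA hS hδ c e b)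
    ((n : ℤ) • (-z)) μ ν
  rw [TOfLeg_eq]
  show (1 / 2 : ℝ) * tadpole A (tableRedF n Wf μ 0 ν z) - (1 / 2 : ℝ) * bubble A (vertexRedF n S μ 0) (vertexRedF n S ν z) = _
  rw [sub_eq_add_neg, ← neg_mul, tadpolePartA_eq_dressedEntryP n A hA hAcov hW hδ hWcov,
    bubblePartA_eq_dressedEntryP n A hA hAcov hS hδ hScov, ← hadd]
  rfl

/-! ## §3 Composition with K-R5: no dressing cross term for the reduced kernel over any leg -/

/-- [folklore] **A4 OVER ANY LEG — THE DRESSING CROSS TERMS OF THE REDUCED ONE-SHOT KERNEL VANISH.**  Leg `A` spread and block covariant;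
`S` self-localised and fine-translation covariant; `Wf` bi-localised at its two fine bonds, jointly covariant and SYMMETRIC.  GIVEN —
hypotheses, the road's Ward (A3.b) and parity (R5-(T1)) inputs for this piece — that every entry of `fineHessA A S Wf` has rows summing
to zero and base-point-summed first moments zero: the coarse BOND second moment `Σ'_z z_κ z_λ · n⁸ · TOfLeg n A S (tableRedF n Wf) μ ν z`
EQUALS `avgM2 n (fineHessA A S Wf μ ν) κ λ`.  Node R5's `X_n = 0` for this piece. -/
theorem bondSecondMoment_TOfLeg_eq_avgM2 (hA : Spr A) (hAcov : ∀ t : Site 4, shiftK (-((n : ℤ) • t)) A = A)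
    (hS : ∀ κ' u, BiLoc (S κ' u) u u Cs δ) (hW : ∀ κ' u l' u', BiLoc (Wf κ' u l' u') u u' C2 δ) (hδ : 0 < δ)
    (hScov : ∀ (κ' : Fin 4) (u v : Site 4), S κ' (u + v) = shiftK (-v) (S κ' u))
    (hWcov : ∀ (κ' : Fin 4) (u : Site 4) (l' : Fin 4) (u' v : Site 4), Wf κ' (u + v) l' (u' + v) = shiftK (-v) (Wf κ' u l' u'))
    (hWsymm : ∀ (κ' : Fin 4) (u : Site 4) (l' : Fin 4) (u' : Site 4), Wf κ' u l' u' = Wf l' u' κ' u)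
    (hrow : ∀ (κ' l' : Fin 4) (b : Site 4), HasSum (fineHessA A S Wf κ' l' b) 0)
    (hT1 : ∀ (κ' l' μ' : Fin 4), ∑ r : Fin 4 → Fin n, ∑' t, (t μ' : ℝ) * baseKer (fineHessA A S Wf κ' l') (resSite r) t = 0)
    (κ lam μ ν : Fin 4) :
    ∑' z : Site 4, ((z κ * z lam : ℤ) : ℝ) * ((n : ℝ) ^ 8 * TOfLeg n A S (tableRedF n Wf) μ ν z)
      = avgM2 n (fineHessA A S Wf μ ν) κ lam := by
  have hcol : ∀ (κ' l' : Fin 4) (b : Site 4), HasSum (fun s => fineHessA A S Wf κ' l' s b) 0 := fun κ' l' b =>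
    (hrow l' κ' b).congr_fun fun s => fineHessA_transpose A hA hS hδ hWsymm κ' l' s b
  have h := bondSecondMomentP_solutionOp_four (N := n) (fineHessA A S Wf) (isBlockPeriodic_fineHessA n A hAcov hScov hWcov)
    (absMoment₂_baseKer_fineHessA A hA hS hW hδ) hcol hrow hT1 κ lam μ ν
  rw [← h, ← (Equiv.neg (Site 4)).tsum_eq]
  refine tsum_congr fun z => ?_
  rw [TOfLeg_tableRedF_eq_dressedEntryP n A hA hAcov hS hW hδ hScov hWcov μ ν]
  simp only [Equiv.neg_apply, Pi.neg_apply, neg_mul_neg, neg_neg]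

/-- [folklore] The same in `B12Beta.secondMoment` currency: `Σ'_z TOfLeg n A S (tableRedF n Wf) μ ν z · z_κ · z_λ = n⁻⁸ · avgM2 n (fineHessA μ ν) κ λ`. -/
theorem secondMoment_TOfLeg_eq (hA : Spr A) (hAcov : ∀ t : Site 4, shiftK (-((n : ℤ) • t)) A = A)
    (hS : ∀ κ' u, BiLoc (S κ' u) u u Cs δ) (hW : ∀ κ' u l' u', BiLoc (Wf κ' u l' u') u u' C2 δ) (hδ : 0 < δ)
    (hScov : ∀ (κ' : Fin 4) (u v : Site 4), S κ' (u + v) = shiftK (-v) (S κ' u))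
    (hWcov : ∀ (κ' : Fin 4) (u : Site 4) (l' : Fin 4) (u' v : Site 4), Wf κ' (u + v) l' (u' + v) = shiftK (-v) (Wf κ' u l' u'))
    (hWsymm : ∀ (κ' : Fin 4) (u : Site 4) (l' : Fin 4) (u' : Site 4), Wf κ' u l' u' = Wf l' u' κ' u)
    (hrow : ∀ (κ' l' : Fin 4) (b : Site 4), HasSum (fineHessA A S Wf κ' l' b) 0)
    (hT1 : ∀ (κ' l' μ' : Fin 4), ∑ r : Fin 4 → Fin n, ∑' t, (t μ' : ℝ) * baseKer (fineHessA A S Wf κ' l') (resSite r) t = 0)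
    (κ lam μ ν : Fin 4) :
    ∑' z : Site 4, TOfLeg n A S (tableRedF n Wf) μ ν z * (z κ : ℝ) * (z lam : ℝ)
      = ((n : ℝ) ^ 8)⁻¹ * avgM2 n (fineHessA A S Wf μ ν) κ lam := by
  have hn' : (n : ℝ) ^ 8 ≠ 0 := pow_ne_zero 8 (by exact_mod_cast NeZero.ne n)
  have h := bondSecondMoment_TOfLeg_eq_avgM2 n A hA hAcov hS hW hδ hScov hWcov hWsymm hrow hT1 κ lam μ ν
  have e : (fun z : Site 4 => ((z κ * z lam : ℤ) : ℝ) * ((n : ℝ) ^ 8 * TOfLeg n A S (tableRedF n Wf) μ ν z))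
      = fun z => (n : ℝ) ^ 8 * (TOfLeg n A S (tableRedF n Wf) μ ν z * (z κ : ℝ) * (z lam : ℝ)) := by
    funext z
    push_cast
    ring
  rw [e, tsum_mul_left] at h
  rw [← h, ← mul_assoc, inv_mul_cancel₀ hn', one_mul]

/-- [folklore] **A4 OVER ANY LEG WITH THE PARITY INPUT DISCHARGED BY AN INVERSION COVARIANCE OF THE EXPLICIT KERNEL**: as
`bondSecondMoment_TOfLeg_eq_avgM2`, but instead of the first-moment hypothesis every entry of `fineHessA A S Wf` is covariant under an
affine inversion `fineHessA κ′λ′ (a₁ κ′ − s) (a₂ λ′ − s′) = fineHessA κ′λ′ s s′`; with the Ward rows this gives (T1-avg) by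
`MomentTransferParity.sum_firstMoment_baseKer_eq_zero_of_inversion`. -/
theorem bondSecondMoment_TOfLeg_eq_avgM2_of_inversion (hA : Spr A) (hAcov : ∀ t : Site 4, shiftK (-((n : ℤ) • t)) A = A)
    (hS : ∀ κ' u, BiLoc (S κ' u) u u Cs δ) (hW : ∀ κ' u l' u', BiLoc (Wf κ' u l' u') u u' C2 δ) (hδ : 0 < δ)
    (hScov : ∀ (κ' : Fin 4) (u v : Site 4), S κ' (u + v) = shiftK (-v) (S κ' u))
    (hWcov : ∀ (κ' : Fin 4) (u : Site 4) (l' : Fin 4) (u' v : Site 4), Wf κ' (u + v) l' (u' + v) = shiftK (-v) (Wf κ' u l' u'))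
    (hWsymm : ∀ (κ' : Fin 4) (u : Site 4) (l' : Fin 4) (u' : Site 4), Wf κ' u l' u' = Wf l' u' κ' u)
    (hrow : ∀ (κ' l' : Fin 4) (b : Site 4), HasSum (fineHessA A S Wf κ' l' b) 0)
    {a₁ a₂ : Fin 4 → Site 4}
    (hinv : ∀ (κ' l' : Fin 4) (s s' : Site 4), fineHessA A S Wf κ' l' (a₁ κ' - s) (a₂ l' - s') = fineHessA A S Wf κ' l' s s')
    (κ lam μ ν : Fin 4) :
    ∑' z : Site 4, ((z κ * z lam : ℤ) : ℝ) * ((n : ℝ) ^ 8 * TOfLeg n A S (tableRedF n Wf) μ ν z)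
      = avgM2 n (fineHessA A S Wf μ ν) κ lam := by
  have hN : 0 < n := Nat.pos_of_ne_zero (NeZero.ne n)
  have hcol : ∀ (κ' l' : Fin 4) (b : Site 4), HasSum (baseKer (fineHessA A S Wf κ' l') b) 0 := fun κ' l' b =>
    ((Equiv.hasSum_iff (Equiv.addLeft b)).mpr
      ((hrow l' κ' b).congr_fun fun s => fineHessA_transpose A hA hS hδ hWsymm κ' l' s b)).congr_fun (fun _ => rfl)
  have hT1 : ∀ (κ' l' μ' : Fin 4), ∑ r : Fin 4 → Fin n, ∑' t, (t μ' : ℝ) * baseKer (fineHessA A S Wf κ' l') (resSite r) t = 0 :=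
    fun κ' l' μ' => sum_firstMoment_baseKer_eq_zero_of_inversion hN (isBlockPeriodic_fineHessA n A hAcov hScov hWcov κ' l')
      (hinv κ' l') (absMoment₂_periodicMajorant (absMoment₂_baseKer_fineHessA A hA hS hW hδ κ' l'))
      (abs_baseKer_le_periodicMajorant hN (isBlockPeriodic_fineHessA n A hAcov hScov hWcov κ' l')) (hcol κ' l') μ'
  exact bondSecondMoment_TOfLeg_eq_avgM2 n A hA hAcov hS hW hδ hScov hWcov hWsymm hrow hT1 κ lam μ ν

/-! ## §4 The ghost instance: leg `Ggh n a`, fibre `Unit` -/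

section Ghost

variable (a : ℝ) {S : Fin 4 → Site 4 → MKer 4 Unit} {Wf : Fin 4 → Site 4 → Fin 4 → Site 4 → MKer 4 Unit} {Cs C2 δ : ℝ}

/-- [folklore] **THE DRESSED GHOST KERNEL IS A SANDWICH**: for `0 < a` (then `Spr (Ggh n a)` and `shiftK (−n•t) (Ggh n a) = Ggh n a` are the
typer's T2 theorems), `TOfGh n a S (tableRedF n Wf) μ ν z = dressedEntryP (wK n) (fineHessA (Ggh n a) S Wf) (n•(−z)) μ ν`. -/
theorem TOfGh_tableRedF_eq_dressedEntryP (ha : 0 < a) (hS : ∀ κ' u, BiLoc (S κ' u) u u Cs δ)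
    (hW : ∀ κ' u l' u', BiLoc (Wf κ' u l' u') u u' C2 δ) (hδ : 0 < δ)
    (hScov : ∀ (κ' : Fin 4) (u v : Site 4), S κ' (u + v) = shiftK (-v) (S κ' u))
    (hWcov : ∀ (κ' : Fin 4) (u : Site 4) (l' : Fin 4) (u' v : Site 4), Wf κ' (u + v) l' (u' + v) = shiftK (-v) (Wf κ' u l' u'))
    (μ ν : Fin 4) (z : Site 4) :
    TOfGh n a S (tableRedF n Wf) μ ν z = dressedEntryP (wK n) (fineHessA (Ggh n a) S Wf) ((n : ℤ) • (-z)) μ ν :=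
  TOfLeg_tableRedF_eq_dressedEntryP n (Ggh n a) (spr_Ggh n a ha) (shiftK_Ggh_neg n a ha) hS hW hδ hScov hWcov μ ν z

/-- [folklore] **A4 FOR THE GHOST SECTOR — NO DRESSING CROSS TERM**: for `0 < a`, GIVEN the Ward rows `hrow` and the base-point-summed first
moments `hT1` of the explicit ghost fine Hessian kernel `fineHessA (Ggh n a) S Wf` (hypotheses), the coarse bond second moment of the dressed
ghost kernel `TOfGh n a S (tableRedF n Wf)` equals `avgM2 n (fineHessA (Ggh n a) S Wf μ ν) κ λ`. -/
theorem bondSecondMoment_TOfGh_eq_avgM2 (ha : 0 < a) (hS : ∀ κ' u, BiLoc (S κ' u) u u Cs δ)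
    (hW : ∀ κ' u l' u', BiLoc (Wf κ' u l' u') u u' C2 δ) (hδ : 0 < δ)
    (hScov : ∀ (κ' : Fin 4) (u v : Site 4), S κ' (u + v) = shiftK (-v) (S κ' u))
    (hWcov : ∀ (κ' : Fin 4) (u : Site 4) (l' : Fin 4) (u' v : Site 4), Wf κ' (u + v) l' (u' + v) = shiftK (-v) (Wf κ' u l' u'))
    (hWsymm : ∀ (κ' : Fin 4) (u : Site 4) (l' : Fin 4) (u' : Site 4), Wf κ' u l' u' = Wf l' u' κ' u)
    (hrow : ∀ (κ' l' : Fin 4) (b : Site 4), HasSum (fineHessA (Ggh n a) S Wf κ' l' b) 0)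
    (hT1 : ∀ (κ' l' μ' : Fin 4),
      ∑ r : Fin 4 → Fin n, ∑' t, (t μ' : ℝ) * baseKer (fineHessA (Ggh n a) S Wf κ' l') (resSite r) t = 0)
    (κ lam μ ν : Fin 4) :
    ∑' z : Site 4, ((z κ * z lam : ℤ) : ℝ) * ((n : ℝ) ^ 8 * TOfGh n a S (tableRedF n Wf) μ ν z)
      = avgM2 n (fineHessA (Ggh n a) S Wf μ ν) κ lam :=
  bondSecondMoment_TOfLeg_eq_avgM2 n (Ggh n a) (spr_Ggh n a ha) (shiftK_Ggh_neg n a ha) hS hW hδ hScov hWcov hWsymm hrow hT1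
    κ lam μ ν

/-- [folklore] The same in `B12Beta.secondMoment` currency: `Σ'_z TOfGh n a S (tableRedF n Wf) μ ν z · z_κ · z_λ =
n⁻⁸ · avgM2 n (fineHessA (Ggh n a) S Wf μ ν) κ λ`. -/
theorem secondMoment_TOfGh_eq (ha : 0 < a) (hS : ∀ κ' u, BiLoc (S κ' u) u u Cs δ)
    (hW : ∀ κ' u l' u', BiLoc (Wf κ' u l' u') u u' C2 δ) (hδ : 0 < δ)
    (hScov : ∀ (κ' : Fin 4) (u v : Site 4), S κ' (u + v) = shiftK (-v) (S κ' u))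
    (hWcov : ∀ (κ' : Fin 4) (u : Site 4) (l' : Fin 4) (u' v : Site 4), Wf κ' (u + v) l' (u' + v) = shiftK (-v) (Wf κ' u l' u'))
    (hWsymm : ∀ (κ' : Fin 4) (u : Site 4) (l' : Fin 4) (u' : Site 4), Wf κ' u l' u' = Wf l' u' κ' u)
    (hrow : ∀ (κ' l' : Fin 4) (b : Site 4), HasSum (fineHessA (Ggh n a) S Wf κ' l' b) 0)
    (hT1 : ∀ (κ' l' μ' : Fin 4),
      ∑ r : Fin 4 → Fin n, ∑' t, (t μ' : ℝ) * baseKer (fineHessA (Ggh n a) S Wf κ' l') (resSite r) t = 0)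
    (κ lam μ ν : Fin 4) :
    ∑' z : Site 4, TOfGh n a S (tableRedF n Wf) μ ν z * (z κ : ℝ) * (z lam : ℝ)
      = ((n : ℝ) ^ 8)⁻¹ * avgM2 n (fineHessA (Ggh n a) S Wf μ ν) κ lam :=
  secondMoment_TOfLeg_eq n (Ggh n a) (spr_Ggh n a ha) (shiftK_Ggh_neg n a ha) hS hW hδ hScov hWcov hWsymm hrow hT1 κ lam μ ν

/-- [folklore] **A4 FOR THE GHOST SECTOR, PARITY BY INVERSION**: the first-moment input discharged by an affine inversion covariance of
`fineHessA (Ggh n a) S Wf`. -/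
theorem bondSecondMoment_TOfGh_eq_avgM2_of_inversion (ha : 0 < a) (hS : ∀ κ' u, BiLoc (S κ' u) u u Cs δ)
    (hW : ∀ κ' u l' u', BiLoc (Wf κ' u l' u') u u' C2 δ) (hδ : 0 < δ)
    (hScov : ∀ (κ' : Fin 4) (u v : Site 4), S κ' (u + v) = shiftK (-v) (S κ' u))
    (hWcov : ∀ (κ' : Fin 4) (u : Site 4) (l' : Fin 4) (u' v : Site 4), Wf κ' (u + v) l' (u' + v) = shiftK (-v) (Wf κ' u l' u'))
    (hWsymm : ∀ (κ' : Fin 4) (u : Site 4) (l' : Fin 4) (u' : Site 4), Wf κ' u l' u' = Wf l' u' κ' u)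
    (hrow : ∀ (κ' l' : Fin 4) (b : Site 4), HasSum (fineHessA (Ggh n a) S Wf κ' l' b) 0)
    {a₁ a₂ : Fin 4 → Site 4}
    (hinv : ∀ (κ' l' : Fin 4) (s s' : Site 4),
      fineHessA (Ggh n a) S Wf κ' l' (a₁ κ' - s) (a₂ l' - s') = fineHessA (Ggh n a) S Wf κ' l' s s')
    (κ lam μ ν : Fin 4) :
    ∑' z : Site 4, ((z κ * z lam : ℤ) : ℝ) * ((n : ℝ) ^ 8 * TOfGh n a S (tableRedF n Wf) μ ν z)
      = avgM2 n (fineHessA (Ggh n a) S Wf μ ν) κ lam :=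
  bondSecondMoment_TOfLeg_eq_avgM2_of_inversion n (Ggh n a) (spr_Ggh n a ha) (shiftK_Ggh_neg n a ha) hS hW hδ hScov hWcov hWsymm
    hrow hinv κ lam μ ν

end Ghost

end Summit.QuantumFields.BalabanUV.Beta.D1BFx.ReducedKernelSandwichLeg

end
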